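import Mathlib.Analysis.SpecialFunctions.Log.Basic
import Literature.Analysis.FluidPDE.FluidComputer.DrainRotor
import Literature.Analysis.FluidPDE.FluidComputer.DrainBuildUp
import HarnessLib

/-!
# Fluid computer blueprint — the self-damping rotor converts (toy model of the drain conversion)

HONEST FRAMING: low prior, high value-of-information experiment on Tao's machine paradigm; NOT a
claim that NS blows up. This file is an elementary theorem about an explicit three-mode quadratic
ODE; nothing is asserted about any fluid equation or about the threshold gate itself.

## What

The EXACT, UNFORCED, UNIT-SPEED model of the threshold gate's drain conversion, written in the
rotor angle `Θ`: a conservative rotation `(a, d)` whose damped coordinate `d` feeds the output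
mode `w` quadratically, and whose damping IS the output,

  `da/dΘ = -d`,   `dd/dΘ = a - k·w·d`,   `dw/dΘ = k·d²`   (`k > 0`).

The energy `E = a² + d² + w²` is conserved (`IsTrajectory.energy_eq`), `w` is nondecreasing
(`IsTrajectory.mono_w`), and the two landed rungs glue into a CONVERSION THEOREM:

* `IsTrajectory.exists_damping_ge_one` (build-up phase, from `DampedRotor.output_buildup`): if
  `w(0) ≥ 0` and the damping CAPACITY exceeds critical, `k²E > 1`, then the self-generated damping
  `γ = k·w` reaches `1` at some angle `Θ₁ ≤ Θ_A := 4(k²E + 1)/(k²E - 1)` (`thetaA`);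
* `IsTrajectory.pair_decay_after` (conversion phase, from `DampedRotor.energy_decay` on the
  shifted window): after such a `Θ₁` the unconverted energy decays,
  `a(Θ)² + d(Θ)² ≤ 3·exp(-(Θ - Θ₁)/(3(1 + k²E)))·(a(Θ₁)² + d(Θ₁)²)`;
* `IsTrajectory.conversion`: for `Θ ≥ Θ_A + 3(1 + k²E)·log 15`, at least `4/5` of the energy
  sits in the output mode: `w(Θ)² ≥ (4/5)·E`.

So in the toy model the nonlinear "the drain converts once triggered" statement that the gate's
transfer stage needs (HOME/pub-fluidc-bp3/NEXT-STAGES.md, item DRAIN CONVERSION) is a theorem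
with an explicit angle, polynomial in `k²E`; the decay constant is the lossy one of `DrainRotor`
(the sharp constant of `DrainConversionSharp` applies while `k·w ≤ 2` and would shorten the second
summand; not pursued here). The gate version differs by forcing, a variable rotor speed `r·c` and
the extra coupling terms, which the time-form rungs (`DrainConversionTime`, `ThresholdDrainWindow`)
already carry as slack.
[cite: Tao2016AveragedNS, §5.5 (the energy-transfer phase of Thm 5.3)]
-/

noncomputable section

open Set Real

namespace Literature.Analysis.FluidPDE.FluidComputer

open Literature.Analysis.ODE

namespace SelfDampingRotor

/-- A trajectory of the self-damping rotor `a' = -d`, `d' = a - k·w·d`, `w' = k·d²` on `[0, ∞)`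
(right derivatives, the functions continuous on `[0, ∞)`). [folklore] -/
structure IsTrajectory (k : ℝ) (a d w : ℝ → ℝ) : Prop where
  cont_a : ContinuousOn a (Ici 0)
  cont_d : ContinuousOn d (Ici 0)
  cont_w : ContinuousOn w (Ici 0)
  deriv_a : ∀ t, 0 ≤ t → HasDerivWithinAt a (-d t) (Ici t) t
  deriv_d : ∀ t, 0 ≤ t → HasDerivWithinAt d (a t - k * w t * d t) (Ici t) t
  deriv_w : ∀ t, 0 ≤ t → HasDerivWithinAt w (k * d t ^ 2) (Ici t) t

/-- The build-up angle `Θ_A = 4(k²E + 1)/(k²E - 1)` by which the self-generated damping `k·w`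
has reached `1` (for `k²E > 1`). [folklore] -/
def thetaA (k E : ℝ) : ℝ := 4 * (k ^ 2 * E + 1) / (k ^ 2 * E - 1)

/-- Translating the time variable does not change a right derivative. [folklore] -/
theorem hasDerivWithinAt_shift {f : ℝ → ℝ} {f' c u : ℝ}
    (hf : HasDerivWithinAt f f' (Ici (c + u)) (c + u)) :
    HasDerivWithinAt (fun v => f (c + v)) f' (Ici u) u := by
  have hg : HasDerivWithinAt (fun v : ℝ => c + v) 1 (Ici u) u :=
    (hasDerivWithinAt_id u (Ici u)).const_add c
  have hm : MapsTo (fun v : ℝ => c + v) (Ici u) (Ici (c + u)) := fun v hv => by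
    have hv' : u ≤ v := hv
    show c + u ≤ c + v
    linarith
  have := hf.comp u hg hm
  simpa [Function.comp_def] using this

namespace IsTrajectory

variable {k : ℝ} {a d w : ℝ → ℝ}

/-- Energy conservation: `a² + d² + w²` is constant along a trajectory. [folklore] -/
theorem energy_eq (h : IsTrajectory k a d w) {t : ℝ} (ht : 0 ≤ t) :
    a t ^ 2 + d t ^ 2 + w t ^ 2 = a 0 ^ 2 + d 0 ^ 2 + w 0 ^ 2 := by
  set f : ℝ → ℝ := fun s => a s * a s + d s * d s + w s * w s with hf_def
  set f' : ℝ → ℝ := fun s => -d s * a s + a s * -d s +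
      ((a s - k * w s * d s) * d s + d s * (a s - k * w s * d s)) +
      (k * d s ^ 2 * w s + w s * (k * d s ^ 2)) with hf'_def
  have hsub : Icc 0 t ⊆ Ici 0 := Icc_subset_Ici_self
  have hfc : ContinuousOn f (Icc 0 t) := by
    have ha := h.cont_a.mono hsub
    have hd := h.cont_d.mono hsub
    have hw := h.cont_w.mono hsub
    exact ((ha.mul ha).add (hd.mul hd)).add (hw.mul hw)
  have hfd : ∀ s ∈ Ico 0 t, HasDerivWithinAt f (f' s) (Ici s) s := by
    intro s hs
    have ha := h.deriv_a s hs.1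
    have hd := h.deriv_d s hs.1
    have hw := h.deriv_w s hs.1
    exact ((ha.mul ha).add (hd.mul hd)).add (hw.mul hw)
  have hzero : ∀ s ∈ Ico 0 t, f' s = 0 := by
    intro s _
    simp only [hf'_def]
    ring
  have h1 := le_of_deriv_right_nonneg hfc hfd (fun s hs => (hzero s hs).symm.le) t ⟨ht, le_rfl⟩
  have h2 := le_of_deriv_right_nonpos hfc hfd (fun s hs => (hzero s hs).le) t ⟨ht, le_rfl⟩
  have hft : f t = f 0 := le_antisymm h2 h1
  simp only [hf_def] at hft
  simp only [sq]
  linarith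

/-- Each mode is bounded by the (conserved) energy. [folklore] -/
theorem sq_le_energy (h : IsTrajectory k a d w) {t : ℝ} (ht : 0 ≤ t) :
    a t ^ 2 ≤ a 0 ^ 2 + d 0 ^ 2 + w 0 ^ 2 ∧ d t ^ 2 ≤ a 0 ^ 2 + d 0 ^ 2 + w 0 ^ 2 ∧
      w t ^ 2 ≤ a 0 ^ 2 + d 0 ^ 2 + w 0 ^ 2 := by
  have he := h.energy_eq ht
  refine ⟨?_, ?_, ?_⟩ <;> nlinarith [sq_nonneg (a t), sq_nonneg (d t), sq_nonneg (w t)]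

/-- The output mode is nondecreasing (`w' = k·d² ≥ 0`). [folklore] -/
theorem mono_w (h : IsTrajectory k a d w) (hk : 0 ≤ k) {s t : ℝ} (hs : 0 ≤ s) (hst : s ≤ t) :
    w s ≤ w t := by
  have hc : ContinuousOn w (Icc s t) := h.cont_w.mono fun x hx => hs.trans hx.1
  have hd : ∀ x ∈ Ico s t, HasDerivWithinAt w (k * d x ^ 2) (Ici x) x :=
    fun x hx => h.deriv_w x (hs.trans hx.1)
  exact le_of_deriv_right_nonneg hc hd (fun x _ => by positivity) t ⟨hst, le_rfl⟩

/-- **Build-up phase.** With `w(0) ≥ 0` and super-critical damping capacity `k²E > 1`, the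
self-generated damping `k·w` reaches `1` by the angle `thetaA k E`. Proof: otherwise
`DampedRotor.output_buildup` (with `Φ = w`, `K₀ = k`, `γ₁ = 1`, `u₀ = E - 1/k²`, no forcing)
forces `w(Θ_A) ≥ w(0) + 1/k`. [folklore] -/
theorem exists_damping_ge_one (h : IsTrajectory k a d w) (hk : 0 < k) (hw0 : 0 ≤ w 0)
    {E : ℝ} (hE : E = a 0 ^ 2 + d 0 ^ 2 + w 0 ^ 2) (hkE : 1 < k ^ 2 * E) :
    ∃ Θ₁ ∈ Icc 0 (thetaA k E), 1 ≤ k * w Θ₁ := by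
  by_contra hcon
  simp only [not_exists, not_and, not_le] at hcon
  have hE0 : 0 ≤ E := by rw [hE]; positivity
  have hden : 0 < k ^ 2 * E - 1 := sub_pos.2 hkE
  have hA : 0 ≤ thetaA k E := by
    unfold thetaA
    exact div_nonneg (by positivity) hden.le
  set T := thetaA k E with hT
  set R := Real.sqrt E with hR
  have hRsq : R ^ 2 = E := Real.sq_sqrt hE0
  have hR0 : 0 ≤ R := Real.sqrt_nonneg _
  have hsub : Icc 0 T ⊆ Ici 0 := Icc_subset_Ici_self
  have hac : ContinuousOn a (Icc 0 T) := h.cont_a.mono hsub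
  have hdc : ContinuousOn d (Icc 0 T) := h.cont_d.mono hsub
  have hwc : ContinuousOn w (Icc 0 T) := h.cont_w.mono hsub
  have ha' : ∀ s ∈ Ico 0 T, HasDerivWithinAt a ((fun s => -d s) s) (Ici s) s :=
    fun s hs => h.deriv_a s hs.1
  have hd' : ∀ s ∈ Ico 0 T,
      HasDerivWithinAt d ((fun s => a s - k * w s * d s) s) (Ici s) s :=
    fun s hs => h.deriv_d s hs.1
  have hw' : ∀ s ∈ Ico 0 T, HasDerivWithinAt w ((fun s => k * d s ^ 2) s) (Ici s) s :=
    fun s hs => h.deriv_w s hs.1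
  have hK : ∀ s ∈ Ico 0 T, k * d s ^ 2 ≤ (fun s => k * d s ^ 2) s := fun s _ => le_rfl
  have hw_nonneg : ∀ s, 0 ≤ s → 0 ≤ w s := fun s hs => hw0.trans (h.mono_w hk.le le_rfl hs)
  have hγ : ∀ s ∈ Ico 0 T, 0 ≤ (fun s => k * w s) s ∧ (fun s => k * w s) s ≤ 1 := by
    intro s hs
    exact ⟨mul_nonneg hk.le (hw_nonneg s hs.1), (hcon s (Ico_subset_Icc_self hs)).le⟩
  have hab : ∀ s ∈ Icc 0 T, |a s| ≤ R ∧ |d s| ≤ R := by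
    intro s hs
    obtain ⟨h1, h2, -⟩ := h.sq_le_energy hs.1
    exact ⟨Real.abs_le_sqrt (by rw [hE]; exact h1), Real.abs_le_sqrt (by rw [hE]; exact h2)⟩
  have hu : ∀ s ∈ Ico 0 T, E - 1 / k ^ 2 ≤ a s ^ 2 + d s ^ 2 := by
    intro s hs
    have he := h.energy_eq hs.1
    have hws : k * w s < 1 := hcon s (Ico_subset_Icc_self hs)
    have hw0s : 0 ≤ w s := hw_nonneg s hs.1
    have hkw0 : 0 ≤ k * w s := mul_nonneg hk.le hw0s
    have h1 : (k * w s) ^ 2 ≤ 1 := by nlinarith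
    have h2 : w s ^ 2 ≤ 1 / k ^ 2 := by
      rw [le_div_iff₀ (by positivity)]
      nlinarith [h1]
    rw [hE]
    linarith
  have hp : ∀ s ∈ Ico 0 T, |(fun s => -d s) s + d s| ≤ 0 := by
    intro s _
    simp
  have hq : ∀ s ∈ Ico 0 T,
      |(fun s => a s - k * w s * d s) s - (a s - (fun s => k * w s) s * d s)| ≤ 0 := by
    intro s _
    simp
  have hmain := DampedRotor.output_buildup (T := T) (K₀ := k) (γ₁ := 1) (R := R) (η := 0)
    (u₀ := E - 1 / k ^ 2) hac hdc hwc ha' hd' hw' hk.le hK hγ (by norm_num) hR0 le_rfl hab hu hp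
    hq T ⟨hA, le_rfl⟩
  have hkey : k / 2 * ((1 - 1 / 2) * (E - 1 / k ^ 2) - 2 * R * 0) * T = k * E + 1 / k := by
    have hk0 : k ≠ 0 := hk.ne'
    have hden0 : k ^ 2 * E - 1 ≠ 0 := hden.ne'
    simp only [hT, thetaA]
    field_simp
    ring
  rw [hRsq, hkey] at hmain
  have hlt : k * w T < 1 := hcon T ⟨hA, le_rfl⟩
  have h3 : k * (w 0 + 1 / k) ≤ k * w T := mul_le_mul_of_nonneg_left (by linarith) hk.le
  have h4 : k * (w 0 + 1 / k) = k * w 0 + 1 := by field_simp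
  have h5 : 0 ≤ k * w 0 := mul_nonneg hk.le hw0
  linarith

/-- **Conversion phase.** Once the self-generated damping has reached `1` (at `Θ₁`), it stays in
the band `[1, k·√E]` (monotonicity of `w`, energy bound), and `DampedRotor.energy_decay` on the
shifted window gives exponential decay of the unconverted energy in angle. [folklore] -/
theorem pair_decay_after (h : IsTrajectory k a d w) (hk : 0 < k)
    {E : ℝ} (hE : E = a 0 ^ 2 + d 0 ^ 2 + w 0 ^ 2)
    {Θ₁ : ℝ} (hΘ₁ : 0 ≤ Θ₁) (hγ₁ : 1 ≤ k * w Θ₁) {Θ : ℝ} (hΘ : Θ₁ ≤ Θ) :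
    a Θ ^ 2 + d Θ ^ 2 ≤
      3 * exp (-(1 / (3 * (1 + k ^ 2 * E))) * (Θ - Θ₁)) * (a Θ₁ ^ 2 + d Θ₁ ^ 2) := by
  have hE0 : 0 ≤ E := by rw [hE]; positivity
  set R := Real.sqrt E with hR
  have hRsq : R ^ 2 = E := Real.sq_sqrt hE0
  have hR0 : 0 ≤ R := Real.sqrt_nonneg _
  set T := Θ - Θ₁ with hT
  have hT0 : 0 ≤ T := sub_nonneg.2 hΘ
  set aS : ℝ → ℝ := fun u => a (Θ₁ + u) with haS
  set dS : ℝ → ℝ := fun u => d (Θ₁ + u) with hdS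
  set γS : ℝ → ℝ := fun u => k * w (Θ₁ + u) with hγS
  have hmaps : MapsTo (fun u : ℝ => Θ₁ + u) (Icc 0 T) (Ici 0) := fun u hu => by
    show 0 ≤ Θ₁ + u
    linarith [hu.1]
  have hshift : Continuous fun u : ℝ => Θ₁ + u := continuous_const.add continuous_id
  have hac : ContinuousOn aS (Icc 0 T) := h.cont_a.comp hshift.continuousOn hmaps
  have hdc : ContinuousOn dS (Icc 0 T) := h.cont_d.comp hshift.continuousOn hmaps
  have ha' : ∀ u ∈ Ico 0 T, HasDerivWithinAt aS ((fun u => -dS u) u) (Ici u) u := by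
    intro u hu
    exact hasDerivWithinAt_shift (h.deriv_a (Θ₁ + u) (by linarith [hu.1]))
  have hd' : ∀ u ∈ Ico 0 T,
      HasDerivWithinAt dS ((fun u => aS u - γS u * dS u) u) (Ici u) u := by
    intro u hu
    exact hasDerivWithinAt_shift (h.deriv_d (Θ₁ + u) (by linarith [hu.1]))
  have hγ : ∀ u ∈ Ico 0 T, 1 ≤ γS u ∧ γS u ≤ k * R := by
    intro u hu
    have hu0 : 0 ≤ Θ₁ + u := by linarith [hu.1]
    have hmono : w Θ₁ ≤ w (Θ₁ + u) := h.mono_w hk.le hΘ₁ (by linarith [hu.1])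
    obtain ⟨-, -, hw2⟩ := h.sq_le_energy hu0
    have hwle : w (Θ₁ + u) ≤ R :=
      (le_abs_self _).trans (Real.abs_le_sqrt (by rw [hE]; exact hw2))
    exact ⟨hγ₁.trans (mul_le_mul_of_nonneg_left hmono hk.le),
      mul_le_mul_of_nonneg_left hwle hk.le⟩
  have hab : ∀ u ∈ Ico 0 T, |aS u| ≤ R ∧ |dS u| ≤ R := by
    intro u hu
    obtain ⟨h1, h2, -⟩ := h.sq_le_energy (show 0 ≤ Θ₁ + u by linarith [hu.1])
    exact ⟨Real.abs_le_sqrt (by rw [hE]; exact h1), Real.abs_le_sqrt (by rw [hE]; exact h2)⟩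
  have hp : ∀ u ∈ Ico 0 T, |(fun u => -dS u) u + dS u| ≤ 0 := by
    intro u _
    simp
  have hq : ∀ u ∈ Ico 0 T,
      |(fun u => aS u - γS u * dS u) u - (aS u - γS u * dS u)| ≤ 0 := by
    intro u _
    simp
  have hmain := DampedRotor.energy_decay (γ₀ := 1) (γ₁ := k * R) (R := R) (η := 0) (T := T)
    hac hdc ha' hd' one_pos hγ hR0 le_rfl hab hp hq T ⟨hT0, le_rfl⟩
  have hkR : (k * R) ^ 2 = k ^ 2 * E := by rw [mul_pow, hRsq]
  have hΘT : Θ₁ + T = Θ := by rw [hT]; ring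
  simp only [haS, hdS, add_zero, mul_zero, zero_div, hkR, hΘT] at hmain
  exact hmain

/-- **The self-damping rotor converts.** With `w(0) ≥ 0` and `k²E > 1`, for every angle
`Θ ≥ 4(k²E + 1)/(k²E - 1) + 3(1 + k²E)·log 15` at least four fifths of the (conserved) energy
`E = a(0)² + d(0)² + w(0)²` sits in the output mode: `w(Θ)² ≥ (4/5)·E`. [folklore] -/
theorem conversion (h : IsTrajectory k a d w) (hk : 0 < k) (hw0 : 0 ≤ w 0)
    {E : ℝ} (hE : E = a 0 ^ 2 + d 0 ^ 2 + w 0 ^ 2) (hkE : 1 < k ^ 2 * E) {Θ : ℝ}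
    (hΘ : thetaA k E + 3 * (1 + k ^ 2 * E) * Real.log 15 ≤ Θ) :
    4 / 5 * E ≤ w Θ ^ 2 := by
  obtain ⟨Θ₁, hΘ₁mem, hγ₁⟩ := h.exists_damping_ge_one hk hw0 hE hkE
  have hE0 : 0 ≤ E := by rw [hE]; positivity
  have hpos : 0 < 3 * (1 + k ^ 2 * E) := by positivity
  have hlog : 0 ≤ Real.log 15 := Real.log_nonneg (by norm_num)
  have hΘB : 0 ≤ 3 * (1 + k ^ 2 * E) * Real.log 15 := mul_nonneg hpos.le hlog
  have hΘ₁Θ : Θ₁ ≤ Θ := by linarith [hΘ₁mem.2]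
  have hΘ0 : 0 ≤ Θ := hΘ₁mem.1.trans hΘ₁Θ
  have hdec := h.pair_decay_after hk hE hΘ₁mem.1 hγ₁ hΘ₁Θ
  have hlam : 0 ≤ 1 / (3 * (1 + k ^ 2 * E)) := by positivity
  have hexp : exp (-(1 / (3 * (1 + k ^ 2 * E))) * (Θ - Θ₁)) ≤ 1 / 15 := by
    have hB : 3 * (1 + k ^ 2 * E) * Real.log 15 ≤ Θ - Θ₁ := by linarith [hΘ₁mem.2]
    have h2 : 1 / (3 * (1 + k ^ 2 * E)) * (3 * (1 + k ^ 2 * E) * Real.log 15) = Real.log 15 := by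
      field_simp
    have h3 := mul_le_mul_of_nonneg_left hB hlam
    have h1 : -(1 / (3 * (1 + k ^ 2 * E))) * (Θ - Θ₁) ≤ -Real.log 15 := by linarith
    calc exp (-(1 / (3 * (1 + k ^ 2 * E))) * (Θ - Θ₁))
        ≤ exp (-Real.log 15) := exp_le_exp.2 h1
      _ = 1 / 15 := by rw [Real.exp_neg, Real.exp_log (by norm_num), one_div]
  have hpair₁ : a Θ₁ ^ 2 + d Θ₁ ^ 2 ≤ E := by
    have he := h.energy_eq hΘ₁mem.1
    rw [hE]
    nlinarith [sq_nonneg (w Θ₁)]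
  have hpair : a Θ ^ 2 + d Θ ^ 2 ≤ E / 5 := by
    have hnn : 0 ≤ a Θ₁ ^ 2 + d Θ₁ ^ 2 := by positivity
    have hmul := mul_le_mul hexp hpair₁ hnn (by norm_num : (0 : ℝ) ≤ 1 / 15)
    calc a Θ ^ 2 + d Θ ^ 2
        ≤ 3 * exp (-(1 / (3 * (1 + k ^ 2 * E))) * (Θ - Θ₁)) * (a Θ₁ ^ 2 + d Θ₁ ^ 2) := hdec
      _ ≤ 3 * (1 / 15 * E) := by nlinarith [hmul]
      _ = E / 5 := by ring
  have he := h.energy_eq hΘ0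
  rw [hE] at hpair ⊢
  linarith

end IsTrajectory

end SelfDampingRotor

end Literature.Analysis.FluidPDE.FluidComputer

end
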